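import Summits.Ventures.DiscreteObjects.Hadamard.Order167Normalizer668

/-!
# H(668): whatever normalises an element of order 334 centralises or inverts it (kernel corollary of the order-167 theorem)

Framing: lottery ticket; floor = certified bounds/negative ranges.

Cell pub-namedobj (venture DiscreteObjects), target (H), hadamard gen 20.  Let `g = (π, κ, d, e)` be a signed automorphism of a
Hadamard matrix of order `668` whose permutation pair has order exactly `334` (`π^334 = κ^334 = 1`, `(π^167, κ^167) ≠ (1,1)`,
`(π², κ²) ≠ (1,1)`; the Ito / negacyclic line of the census, gen 19 `Order334NegacyclicArray668`), and `τ = (π', κ', d', e')` a signed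
automorphism with `π'π = π^m π'`, `κ'κ = κ^m κ'`.  Then (**`hadamard668_order334_normalizer_sq_eq_one`**) **`m² ≡ 1 (mod 334)`**:
`τ g τ⁻¹ ∈ {g, g⁻¹}`.  [`g²` has pair order `167` and `τ` normalises it with multiplier `m` (`π'π² = (π²)^m π'`), so `m² ≡ 1 (mod 167)`
by `hadamard668_order167_normalizer_sq_eq_one_general`; `m` is odd, since for even `m` the conjugate `π^m = (π²)^{m/2}` would satisfy
`(π^m)^167 = 1`, forcing `π^167 = 1` (and likewise `κ^167 = 1`); `167` and `2` are coprime.]  So `N(⟨g⟩)/C(⟨g⟩) ≤ C₂` for the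
elements of order 334 as well: no `C₃₃₄ ⋊ C₈₃`, no `C₁₆₇ ⋊ C₁₆₆ ≅` (odd part) inside Aut± of a hypothetical H(668).  EXCLUSION of a
symmetry type; no order excluded; H(668) untouched; HITS 0/4.  Ours; no `sorry`, no definitions.
-/

namespace Summit.Ventures.DiscreteObjects.Hadamard

open Finset BigOperators Matrix

open Literature.Combinatorics.Designs.GoethalsSeidel (IsHadamardMatrix)

variable {ι : Type*} [Fintype ι] [DecidableEq ι]

omit [Fintype ι] [DecidableEq ι] in
/-- if `ψ ρ = ρ^m ψ` with `m` even and `ρ^334 = 1`, then `ρ^167 = 1` -/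
lemma pow167_eq_one_of_even_multiplier {ρ ψ : Equiv.Perm ι} {m : ℕ} (hn : ψ * ρ = ρ ^ m * ψ) (hρ : ρ ^ 334 = 1)
    (hm : Even m) : ρ ^ 167 = 1 := by
  obtain ⟨k, rfl⟩ := hm
  -- ψ ρ^167 = ρ^((k+k)·167) ψ = (ρ^334)^k ψ = ψ
  have h1 := norm_comm_pow hn 167
  rw [show (k + k) * 167 = 334 * k by ring, pow_mul, hρ, one_pow, one_mul] at h1
  have h2 : ψ * ρ ^ 167 = ψ * 1 := by rw [h1, mul_one]
  exact mul_left_cancel h2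

/-- **EXCLUSION (order 334): every signed automorphism normalising an element of pair order 334 acts on it as `±1`.**
`g = (π, κ, d, e)` with `π^334 = κ^334 = 1`, `(π^167, κ^167) ≠ (1,1)`, `(π², κ²) ≠ (1,1)`; `τ` with `π'π = π^m π'`, `κ'κ = κ^m κ'` ⇒
**`m² ≡ 1 (mod 334)`**. -/
theorem hadamard668_order334_normalizer_sq_eq_one {H : Matrix ι ι ℤ} (hH : IsHadamardMatrix H) (hι : Fintype.card ι = 668)
    {π κ π' κ' : Equiv.Perm ι} {d e d' e' : ι → ℤ} (haut : IsSignedAut H π κ d e)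
    (hπ : π ^ 334 = 1) (hκ : κ ^ 334 = 1) (h167 : π ^ 167 ≠ 1 ∨ κ ^ 167 ≠ 1) (h2 : π ^ 2 ≠ 1 ∨ κ ^ 2 ≠ 1)
    (haut' : IsSignedAut H π' κ' d' e') {m : ℕ} (hnπ : π' * π = π ^ m * π') (hnκ : κ' * κ = κ ^ m * κ') :
    (m : ZMod 334) ^ 2 = 1 := by
  -- m is odd
  have hodd : Odd m := by
    rcases Nat.even_or_odd m with hm | hm
    · exfalso
      rcases h167 with h | h
      · exact h (pow167_eq_one_of_even_multiplier hnπ hπ hm)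
      · exact h (pow167_eq_one_of_even_multiplier hnκ hκ hm)
    · exact hm
  -- g² has pair order 167 and τ normalises it with multiplier m
  have hσπ : (π ^ 2) ^ 167 = 1 := by rw [← pow_mul]; exact hπ
  have hσκ : (κ ^ 2) ^ 167 = 1 := by rw [← pow_mul]; exact hκ
  have hnπ2 : π' * π ^ 2 = (π ^ 2) ^ m * π' := by rw [norm_comm_pow hnπ 2, ← pow_mul, mul_comm]
  have hnκ2 : κ' * κ ^ 2 = (κ ^ 2) ^ m * κ' := by rw [norm_comm_pow hnκ 2, ← pow_mul, mul_comm]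
  have h167sq := hadamard668_order167_normalizer_sq_eq_one_general hH hι (isSignedAut_pow haut 2) hσπ hσκ h2
    haut' hnπ2 hnκ2
  -- m² ≡ 1 (mod 167) and m odd ⇒ m² ≡ 1 (mod 334)
  have h167dvd : 167 ∣ m ^ 2 - 1 := by
    have h1 : ((m ^ 2 : ℕ) : ZMod 167) = ((1 : ℕ) : ZMod 167) := by push_cast; exact h167sq
    rw [ZMod.natCast_eq_natCast_iff'] at h1
    have hm1 : 1 ≤ m ^ 2 := Nat.one_le_pow _ _ hodd.pos
    exact (Nat.modEq_iff_dvd' hm1).mp h1.symm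
  have h2dvd : 2 ∣ m ^ 2 - 1 := by
    obtain ⟨k, rfl⟩ := hodd
    exact ⟨2 * k ^ 2 + 2 * k, by ring_nf; omega⟩
  have h334 : 334 ∣ m ^ 2 - 1 := by
    have hcop : Nat.Coprime 2 167 := by norm_num
    have := Nat.Coprime.mul_dvd_of_dvd_of_dvd hcop h2dvd h167dvd
    simpa using this
  have hm1 : 1 ≤ m ^ 2 := Nat.one_le_pow _ _ hodd.pos
  have hmod : m ^ 2 % 334 = 1 % 334 := ((Nat.modEq_iff_dvd' hm1).mpr h334).symm
  have : ((m ^ 2 : ℕ) : ZMod 334) = ((1 : ℕ) : ZMod 334) := (ZMod.natCast_eq_natCast_iff' _ _ _).mpr hmod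
  push_cast at this
  exact this

end Summit.Ventures.DiscreteObjects.Hadamard
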